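import Literature.MathematicalPhysics.QuantumFieldTheory.Balaban1983to89.B2Eq37RemainingIntegral

/-!
# `Balaban1983to89.B2Eq37QuadraticForm` — T. Bałaban, *(Higgs)₂,₃ quantum fields in a finite volume. II. An upper bound*,
Commun. Math. Phys. **86** (1982) 555–594 [Balaban1982Higgs2] pp. 584–585 [PDF 30–31]: **the exponential of (3.7) as a
QUADRATIC POLYNOMIAL in the integrated fields `A_k↾_{Λ₅⁽ᵏ⁾}`, `φ_k↾_{Λ₅⁽ᵏ⁾}`** — the structural half of p. 585's sentence *"Then
the integral (3.7), after removing all the terms independent of these fields, is of the form [the Gaussian integral (3.9)]"*,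
for p23 g25's concrete display `B2Eq37RemainingIntegral.Data37.display37` on the (Higgs)₂,₃ carrier: constant + linear −
½·quadratic, the quadratic part of the two averaging lines being p23 g11's (3.9)-object `Geom39.sqForm39` and the quadratic
part of the three operator lines being the `Λ₅⁽ᵏ⁾`-blocks of (3.7)'s own operators (`quad37`, `exponent37_split`,
`display37_gaussian`); and the printed mechanism *"it suffices to use the mass terms in the fundamental operators"* applied
to (3.7)'s own quadratic form (`quad37_ge`, `quad37_ge_of_hForm_le`)

statement-level skeleton of published theorems with citation tags; proofs where landed; nothing here is a claim about the Yang–Mills mass gap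

PDF held: `paper:balaban1982-cmp86-higgs23-ii` (journal page = PDF page + 554); pp. 584–585 [PDF 30–31] read as images by
p23 g25 (render `run/shared/lean/pub/lit-balaban/lit-balaban-p23/lean/B2-p584-PDF30-x2.5.png`) and transcribed verbatim in the
module header of `B2Eq37RemainingIntegral` ((3.7), the (2.108)/(3.8)/(2.49) sentences) and of `B2Eq39ConcreteForms` ((3.9),
(3.11) and the sentences between them); nothing is re-read here.

CITATION HEADER (lean-in-tree rule).  lit-balaban typed skeleton (HOME `run/shared/lean/pub/lit-balaban/`), Phase-2 proof
seat **p23** gen 26 (unit `lit-balaban-p23-g26`; TAKING #1 line HOME/STATUS.md 2026-08-23T20:43:27Z; item (i) of HOME/HANDOFF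
§ «lit-balaban-p23 gen 25»).  SKELETON row **B2.Eq3.1-3.10** ((3.1)–(3.10) pp. 583–585; owner r02, second reader r14, referee
ref-4) — a CELLS-ONLY companion of the member (3.7) `B2Eq37RemainingIntegral` (p23 g25 p371416, r14 SECONDREAD-B2 v62 PASS · AS
PRINTED); no head change is claimed.  USED BY NAME, NOTHING RESTATED: `B2Eq37RemainingIntegral.{Data37, fld37, fld37_eq,
fieldOfCrd_apply_of_not_mem, sqTerms37, linTerms37, Data37.sqVec37/sqScal37/dVec37/dScal37/hForm37/exponent37/chiProd37/display37,
Data37.sqVec37_split, Data37.sqScal37_split, Data37.display37_factor, exists_data37}` (p23 g25), `B2Eq39ConcreteForms.{Geom39,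
Geom39.sqForm39, Geom39.sqForm39_nonneg, exists_geom39}` (p23 g11), p35's `B1Eq230FluctCov.deltaKA` with its symmetry
`B1Eq230FluctCovPos.siteInner_deltaKA_comm` (I (2.21)), r02 g7's mass-term bound `B2Ineq311DeltaKConcrete.siteInner_deltaKA_succ_ge_uniform`
((3.11) for `Δ⁽ᵏ⁾(Ω, Ã)`, `k ≥ 1`), the typer's `HiggsLattice.siteInner`, `B2Eq255Concrete.cutTo`, `HiggsCondGauss228.{fieldOfCrd,
inSet}`, `B2Eq228Conditioning.In`.

THE SOURCE TEXT (verbatim, pp. 584–585; the displays are in the two files named above).  p. 584 after (3.7): *"Also we have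
applied formula (2.108) together with the remark following it to the expression in the exponent in (3.5). According to the
remark, the matrix elements h_k(x, x′) of the operator H_k satisfy the estimates |h_k(x, x′)| ≦ O(1)exp(−δ₁r(Lᵏε))exp(−δ₀|x − x′|),
x, x′ ∈ Λ₆^{(k−1)′}. (3.8)  Further we apply formula (2.49) and we replace ρ′⁽ᵏ⁾ exp[(the proper quadratic forms)] by ρ⁽ᵏ⁾. Next
we complete and transform the quadratic forms in ρ⁽ᵏ⁾ to the forms appearing in formula (2.46) for the density ρ″⁽ᵏ⁾. The
differences can be written again as the forms satisfying the property (3.8)."*  p. 585: *"Let us consider formula (2.46) for the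
density ρ″⁽ᵏ⁾, and let us take these expressions which depend on the fields A_k↾_{Λ₅⁽ᵏ⁾}, φ_k↾_{Λ₅⁽ᵏ⁾}. Then the integral (3.7),
after removing all the terms independent of these fields, is of the form"* (3.9) *"… We need the estimates of the quadratic
forms in (3.9). … We will give the estimates from below for these forms. It is sufficient to get very weak estimates because we
have the strong estimates (3.8), (3.10). To get them it suffices to use the mass terms in the fundamental operators
−Δ^η + μ₀²(Lᵏε)² and −Δ^{η,N}_{Ã⁽ᵏ⁾,Bᵏ(Λ₂^{(k−1)′})} + m²(Lᵏε)²."*  p. 558 (2.8) `Λ₇ ⊂ Λ₆ ⊂ Λ₅ ⊂ ⋯ ⊂ Λ₀`, p. 566 *"Λ₀^{(j+1)} ⊂ Λ₇^{(j)′}"*: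
hence `Λ₅⁽ᵏ⁾ ⊂ Λ₀⁽ᵏ⁾ ⊂ Λ₇^{(k−1)′} ⊂ Λ₆^{(k−1)′}` — the two set hypotheses of this file (DISCHARGED for Bałaban's tower in the sequel
`B2Eq37RemainingIntegralTower`).

THE ARGUMENT (elementary; print does not display it).  Write the field of the step as `A_k = Λ₅ᶜA_k + x̂`, `φ_k = Λ₅ᶜφ_k + x̂′`
with `x̂`, `x̂′` supported in `Λ₅⁽ᵏ⁾` (`fld37`).  Lines 1–2 of the exponential of (3.7) (the averaging squares) split into the
squares at `Λ₅ᶜ·`, minus twice the cross terms `linTerms37`, plus p23 g11's `sqForm39` (p23 g25 `sqTerms37_split`).  For the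
operator lines 3–5, `Λ₅⁽ᵏ⁾ ⊂ Λ₆^{(k−1)′}` gives `Λ₆′A_k = Λ₆′Λ₅ᶜA_k + x̂` (`cutTo_fld37_of_subset`), and bilinearity of the scalar
product (I.1.5) with the symmetry of `Δ⁽ᵏ⁾` (p35's `siteInner_deltaKA_comm`) gives `−½⟨u + x̂, Δ(u + x̂)⟩ = −½⟨u, Δu⟩ − ⟨u, Δx̂⟩ −
½⟨x̂, Δx̂⟩`; for `H_k` (a datum, not assumed symmetric) both cross terms are kept.  Collecting: `exponent = exponent(Λ₅ᶜA_k, Λ₅ᶜφ_k)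
+ lin37(x̂, x̂′) − ½·quad37(x̂, x̂′)` with `quad37 = sqForm39_vec(x̂) + ⟨x̂, Δ⁽ᵏ⁾x̂⟩ + sqForm39(x̂′) + ⟨x̂′, Δ⁽ᵏ⁾(Bᵏ(Λ₂′), Ã⁽ᵏ⁾)x̂′⟩ −
⟨x̂′, H_kx̂′⟩`.  The mass terms: `sqForm39 ≥ 0` (p23 g11) and `⟨ψ, Δ^{(k),Lᵏε}(Ω, Ã)ψ⟩ ≥ γm²‖ψ‖²`, `γ = a_∞/(a_∞ + m²)`, `a_∞ =
a(1 − L⁻²)` (r02 g7, every `Ω`, `Ã`, `k ≥ 1`, `Lᵏε ≤ 1`), so `quad37 ≥ γ(μ₀²)μ₀²‖x̂‖² + γ(m²)m²‖x̂′‖² − ⟨x̂′, H_kx̂′⟩`, and a bound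
`⟨x̂′, H_kx̂′⟩ ≤ η‖x̂′‖²` with `η ≤ ½γ(m²)m²` (what (3.8) supplies for `r(Lᵏε)` large, row B2.Eq2.109 / (3.12)) leaves
`½γ(m²)m²‖x̂′‖²` — *"very weak estimates"*.

WHAT IS PROVED (kernel-checked, 0 `sorry`, standard axioms; two DEFINITIONS WITH BODY (`lin37`, `quad37`) + theorems; NO
`Prop`-valued fact).
 §1 `cutTo_fld37_of_subset` (`Λ ⊆ R ⇒ R·fld37 Λ ψ x = R(Λᶜψ) + x̂`), `siteInner_quad_add`,
    `siteInner_quad_add_symm` (bilinear bookkeeping).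
 §2 at the field of the step, under `Λ₅⁽ᵏ⁾ ⊆ Λ₆^{(k−1)′}`: **`dVec37_fld37`**, **`dScal37_fld37`**, **`hForm37_fld37`** (lines 3, 4, 5).
 §3 **`lin37`**, **`quad37`** (with body) and **`exponent37_split`**; `quad37_eq` (unfolding).
 §4 **`display37_gaussian`**: under `Λ₅⁽ᵏ⁾ ⊆ Λ₇^{(k−1)′}` and `Λ₅⁽ᵏ⁾ ⊆ Λ₆^{(k−1)′}`, (3.7) = `χ⋯χ · ρ′⁽ᵏ⁾(…, Λ₇′ᶜA_k, Ã⁽ᵏ⁾, Λ₇′ᶜφ_k) ·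
    e^{exponent(Λ₅ᶜA_k, Λ₅ᶜφ_k)} · ∫dx∫dx′ exp[lin37(x̂, x̂′) − ½quad37(x̂, x̂′)]` — a Gaussian integral in the interior coordinates.
 §5 **`quad37_ge`** (the mass-term lower bound above; m², μ₀² > 0, a > 0, L > 1, `Lᵏε ≤ 1`) and **`quad37_ge_of_hForm_le`**
    (the *"very weak estimates suffice given (3.8)"* corollary under the smallness hypothesis on the `H_k`-form);
    `exists_data37_masks` (non-vacuity of the two set hypotheses: the g25 datum has `Λ₆′ = Λ₇′ = T⁽ᵏ⁾`).
HONEST SCOPE.  (a) `quad37`'s operator part consists of the `Λ₅⁽ᵏ⁾`-blocks of (3.7)'s OWN operators — the unconditioned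
`Δ⁽ᵏ⁾`, `Δ⁽ᵏ⁾(Bᵏ(Λ₂^{(k−1)′}), Ã⁽ᵏ⁾)` (masked by `Λ₆^{(k−1)′}`) and `H_k` —, NOT (3.9)'s conditional `Δ⁽ᵏ⁾_{Λ₅^{(k−1)}}`,
`Δ⁽ᵏ⁾_{Λ₅^{(k−1)}}(Bᵏ(Λ₂^{(k−1)′}), Ã⁽ᵏ⁾)` and `H′_k`, `H″_k`: the p. 584 step between them (*"we apply formula (2.49) … replace
ρ′⁽ᵏ⁾exp[…] by ρ⁽ᵏ⁾ … complete and transform the quadratic forms … the differences … satisfying the property (3.8)"*, and the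
`f′_k, f″_k, F′_k, F″_k` of (3.9)) is NOT claimed; `G′_k`, `G″_k` of record stay p23 g11's `Geom39.form39` (row B2.Eq3.11).  What
IS certified is the shape print asserts for (3.7) after *"removing all the terms independent of these fields"*: a Gaussian
integral whose exponent has exactly the term structure of (3.9) lines 1–6 and 9–10 (averaging squares; a quadratic
`Λ₅`-block and ONE cross term with the exterior field per operator line; an `H`-form), with (3.7)'s operators in the slots.
(b) `H_k` is a datum (a linear operator); no symmetry is assumed (both cross terms appear in `lin37`); the smallness
hypothesis of `quad37_ge_of_hForm_le` is what (3.8)/(3.12) deliver (rows B2.Eq2.109, B2.Eq3.11), not proved here.  (c) The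
constants: `γ(m) = a_∞/(a_∞ + m)`, `a_∞ = a(1 − L⁻²)` (r02 g7's uniform reading of *"the mass terms"*); physical units as in
`B2Eq37RemainingIntegral`/`B2Eq39ConcreteForms` (print's `m²(Lᵏε)²` on the unit lattice is `m²` here).  (d) No convergence or
Gaussian evaluation ((3.13)–(3.20) are rows B2.Eq3.11/B2.Eq3.20); `1 ≤ k ≤ K` as in `Geom39`.  (e) The two set hypotheses are
print's (2.8) + admissibility; they are discharged for the tower of record in `B2Eq37RemainingIntegralTower` (same seat).
Value = the Gaussian structure of the remaining integral (3.7) made explicit and kernel-checked on the carrier of record, with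
the printed *"mass terms"* mechanism applied to it; NOT summit progress.  No row head change is claimed (owner r02).
-/

noncomputable section

open scoped BigOperators InnerProductSpace
open MeasureTheory

namespace Literature.MathematicalPhysics.QuantumFieldTheory.Balaban1983to89.B2Eq37QuadraticForm

open HiggsLattice HiggsAveraging HiggsCovariance HiggsCovariancePos HiggsFluctMeasurePos B1Eq27StepAdjoint B1Eq230FluctCov
  B1Eq230FluctCovPos HiggsCondCov232 HiggsCondGauss228 B2Eq255Concrete B2Eq227CondDelta B2Eq39ConcreteForms B2Eq37RemainingIntegral
open B2Eq228Conditioning (In Out resIn resOut glue)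
open B3MultiscaleFields (zeroCharge)

variable {P : HiggsLattice.Params} {N : ℕ}

/-! ## §1 The mask `Λ₆^{(k−1)′}` sees the integration variable in full; bilinear bookkeeping -/

section Mask

variable {k : ℕ}

/-- **`Λ ⊆ R ⇒ R·(fld37 Λ ψ x) = R·(Λᶜψ) + x̂`** (`x̂ = x` extended by zero): a mask containing `Λ₅⁽ᵏ⁾` — here `Λ₆^{(k−1)′}`,
by (2.8) and p. 566 *"Λ₀^{(j+1)} ⊂ Λ₇^{(j)′}"* — cuts the exterior part of the field of the step and keeps the integration variable.
[cite: Balaban1982Higgs2, (3.7) p.584, (2.8) p.558] -/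
theorem cutTo_fld37_of_subset {N' : ℕ} {Λ R : Finset (HiggsLattice.Site P k)} (h : Λ ⊆ R) (ψ : ScalarField P k N')
    (x : In (inSet (P := P) N' Λ) → ℝ) : cutTo R (fld37 Λ ψ x) = cutTo R (cutTo Λᶜ ψ) + fieldOfCrd Λ x := by
  funext y
  by_cases hyR : y ∈ R
  · rw [cutTo_of_mem R _ hyR, Pi.add_apply, cutTo_of_mem R _ hyR, fld37_eq, Pi.add_apply]
  · have hyΛ : y ∉ Λ := fun h' => hyR (h h')
    rw [cutTo_of_not_mem R _ hyR, Pi.add_apply, cutTo_of_not_mem R _ hyR, fieldOfCrd_apply_of_not_mem Λ x hyΛ, add_zero]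

/-- The quadratic form of a linear operator at a sum: `⟨u + v, T(u + v)⟩ = ⟨u, Tu⟩ + ⟨u, Tv⟩ + ⟨v, Tu⟩ + ⟨v, Tv⟩`.
[cite: Balaban1982Higgs1, (1.5) p.604] [folklore] -/
theorem siteInner_quad_add {N' : ℕ} (T : ScalarField P k N' →ₗ[ℝ] ScalarField P k N') (u v : ScalarField P k N') :
    siteInner (u + v) (T (u + v)) = siteInner u (T u) + siteInner u (T v) + siteInner v (T u) + siteInner v (T v) := by
  rw [map_add, siteInner_add_right, siteInner_comm (u + v) (T u), siteInner_comm (u + v) (T v), siteInner_add_right,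
    siteInner_add_right, siteInner_comm (T u) u, siteInner_comm (T u) v, siteInner_comm (T v) u, siteInner_comm (T v) v]
  ring

/-- The same for an operator SYMMETRIC with respect to (I.1.5): `⟨u + v, T(u + v)⟩ = ⟨u, Tu⟩ + 2⟨u, Tv⟩ + ⟨v, Tv⟩`.
[cite: Balaban1982Higgs1, (1.5) p.604] [folklore] -/
theorem siteInner_quad_add_symm {N' : ℕ} (T : ScalarField P k N' →ₗ[ℝ] ScalarField P k N')
    (hT : ∀ f g : ScalarField P k N', siteInner f (T g) = siteInner g (T f)) (u v : ScalarField P k N') :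
    siteInner (u + v) (T (u + v)) = siteInner u (T u) + 2 * siteInner u (T v) + siteInner v (T v) := by
  rw [siteInner_quad_add, hT v u]
  ring

end Mask

/-! ## §2 The three operator lines of (3.7) at the field of the step -/

section Lines

variable (C : ChargeData N) (μ msq a : ℝ) (D : Data37 P N)

/-- **Line 3 at `A_k = Λ₅ᶜA_k + x̂`** (`Λ₅⁽ᵏ⁾ ⊆ Λ₆^{(k−1)′}`; `u = Λ₆′Λ₅ᶜA_k`, `Δ = Δ⁽ᵏ⁾` the vector operator):
`−½⟨Λ₆′A_k, ΔΛ₆′A_k⟩ = −½⟨u, Δu⟩ − ⟨u, Δx̂⟩ − ½⟨x̂, Δx̂⟩` (symmetry of `Δ⁽ᵏ⁾`, p35's `siteInner_deltaKA_comm`).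
[cite: Balaban1982Higgs2, (3.7) p.584, (3.9) p.585] -/
theorem dVec37_fld37 (h6 : D.G.Λ5 ⊆ D.R6p) (x : In (inSet (P := P) P.d D.G.Λ5) → ℝ) :
    D.dVec37 μ a (fld37 D.G.Λ5 D.Ak x)
      = D.dVec37 μ a (cutTo D.G.Λ5ᶜ D.Ak)
        - siteInner (cutTo D.R6p (cutTo D.G.Λ5ᶜ D.Ak))
            (deltaKA (zeroCharge P.d) Finset.univ (0 : HiggsLattice.VecField P 0) μ a (D.G.j + 1) (fieldOfCrd D.G.Λ5 x))
        - (1 / 2 : ℝ) * siteInner (fieldOfCrd D.G.Λ5 x)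
            (deltaKA (zeroCharge P.d) Finset.univ (0 : HiggsLattice.VecField P 0) μ a (D.G.j + 1) (fieldOfCrd D.G.Λ5 x)) := by
  simp only [Data37.dVec37]
  rw [cutTo_fld37_of_subset h6,
    siteInner_quad_add_symm (deltaKA (zeroCharge P.d) Finset.univ (0 : HiggsLattice.VecField P 0) μ a (D.G.j + 1))
      (siteInner_deltaKA_comm _ _ _ _ _ _)]
  ring

/-- **Line 4 at `φ_k = Λ₅ᶜφ_k + x̂′`** (`u′ = Λ₆′Λ₅ᶜφ_k`, `Δ = Δ⁽ᵏ⁾(Bᵏ(Λ₂^{(k−1)′}), Ã⁽ᵏ⁾)`):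
`−½⟨Λ₆′φ_k, ΔΛ₆′φ_k⟩ = −½⟨u′, Δu′⟩ − ⟨u′, Δx̂′⟩ − ½⟨x̂′, Δx̂′⟩`. [cite: Balaban1982Higgs2, (3.7) p.584, (3.9) p.585] -/
theorem dScal37_fld37 (h6 : D.G.Λ5 ⊆ D.R6p) (x' : In (inSet (P := P) N D.G.Λ5) → ℝ) :
    D.dScal37 C msq a (fld37 D.G.Λ5 D.φk x')
      = D.dScal37 C msq a (cutTo D.G.Λ5ᶜ D.φk)
        - siteInner (cutTo D.R6p (cutTo D.G.Λ5ᶜ D.φk)) (deltaKA C D.Ω D.Atk msq a (D.G.j + 1) (fieldOfCrd D.G.Λ5 x'))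
        - (1 / 2 : ℝ) * siteInner (fieldOfCrd D.G.Λ5 x') (deltaKA C D.Ω D.Atk msq a (D.G.j + 1) (fieldOfCrd D.G.Λ5 x')) := by
  simp only [Data37.dScal37]
  rw [cutTo_fld37_of_subset h6,
    siteInner_quad_add_symm (deltaKA C D.Ω D.Atk msq a (D.G.j + 1)) (siteInner_deltaKA_comm _ _ _ _ _ _)]
  ring

/-- **Line 5 at `φ_k = Λ₅ᶜφ_k + x̂′`** (`H_k` a datum, NOT assumed symmetric — both cross terms kept):
`½⟨Λ₆′φ_k, H_kΛ₆′φ_k⟩ = ½⟨u′, H_ku′⟩ + ½⟨u′, H_kx̂′⟩ + ½⟨x̂′, H_ku′⟩ + ½⟨x̂′, H_kx̂′⟩`. [cite: Balaban1982Higgs2, (3.7) p.584, (2.108) p.580] -/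
theorem hForm37_fld37 (h6 : D.G.Λ5 ⊆ D.R6p) (x' : In (inSet (P := P) N D.G.Λ5) → ℝ) :
    D.hForm37 (fld37 D.G.Λ5 D.φk x')
      = D.hForm37 (cutTo D.G.Λ5ᶜ D.φk)
        + (1 / 2 : ℝ) * siteInner (cutTo D.R6p (cutTo D.G.Λ5ᶜ D.φk)) (D.Hk (fieldOfCrd D.G.Λ5 x'))
        + (1 / 2 : ℝ) * siteInner (fieldOfCrd D.G.Λ5 x') (D.Hk (cutTo D.R6p (cutTo D.G.Λ5ᶜ D.φk)))
        + (1 / 2 : ℝ) * siteInner (fieldOfCrd D.G.Λ5 x') (D.Hk (fieldOfCrd D.G.Λ5 x')) := by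
  simp only [Data37.hForm37]
  rw [cutTo_fld37_of_subset h6, siteInner_quad_add D.Hk]
  ring

/-! ## §3 The linear and the quadratic part; the exponent split -/

/-- **The linear part of the exponential of (3.7) in the integrated fields** `(x̂, x̂′)` (`x̂ = A_k↾Λ₅`, `x̂′ = φ_k↾Λ₅` extended by
zero): the cross terms of the two averaging lines (`linTerms37` at `Λ₅ᶜA_k`, `Λ₅ᶜφ_k`), minus the cross terms `⟨Λ₆′Λ₅ᶜA_k, Δ⁽ᵏ⁾x̂⟩`,
`⟨Λ₆′Λ₅ᶜφ_k, Δ⁽ᵏ⁾(Bᵏ(Λ₂′), Ã⁽ᵏ⁾)x̂′⟩` of lines 3–4 (print's (3.9) carries the analogous single cross term per operator line, lines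
5–6), plus the two `H_k` cross terms of line 5. [cite: Balaban1982Higgs2, (3.7) p.584, (3.9) p.585] -/
def lin37 (xh : ScalarField P (D.G.j + 1) P.d) (xh' : ScalarField P (D.G.j + 1) N) : ℝ :=
  linTerms37 (zeroCharge P.d) (0 : HiggsLattice.VecField P 0) a D.G D.A (cutTo D.G.Λ5ᶜ D.Ak) xh
    + linTerms37 C D.Atk1 a D.G D.φ (cutTo D.G.Λ5ᶜ D.φk) xh'
    - siteInner (cutTo D.R6p (cutTo D.G.Λ5ᶜ D.Ak))
        (deltaKA (zeroCharge P.d) Finset.univ (0 : HiggsLattice.VecField P 0) μ a (D.G.j + 1) xh)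
    - siteInner (cutTo D.R6p (cutTo D.G.Λ5ᶜ D.φk)) (deltaKA C D.Ω D.Atk msq a (D.G.j + 1) xh')
    + (1 / 2 : ℝ) * siteInner (cutTo D.R6p (cutTo D.G.Λ5ᶜ D.φk)) (D.Hk xh')
    + (1 / 2 : ℝ) * siteInner xh' (D.Hk (cutTo D.R6p (cutTo D.G.Λ5ᶜ D.φk)))

/-- **The quadratic form of (3.7) in the integrated fields** (the exponential is `… − ½·quad37`): the averaging squares of
both species — p23 g11's (3.9)-objects `sqForm39` at trivial coupling / at `(C, Ã^{(k+1)})` — plus the `Λ₅⁽ᵏ⁾`-blocks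
`⟨x̂, Δ⁽ᵏ⁾x̂⟩ + ⟨x̂′, Δ⁽ᵏ⁾(Bᵏ(Λ₂^{(k−1)′}), Ã⁽ᵏ⁾)x̂′⟩ − ⟨x̂′, H_kx̂′⟩` of (3.7)'s three operator lines.  (Print's `⟨A_k, G′_kA_k⟩`,
`⟨φ_k, G″_kφ_k⟩` of (3.9) have the conditional operators `Δ⁽ᵏ⁾_{Λ₅^{(k−1)}}` in the operator slots — the (2.49)/(2.46) step, not
claimed; they are p23 g11's `Geom39.form39`.) [cite: Balaban1982Higgs2, (3.7) p.584, (3.9) p.585] -/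
def quad37 (xh : ScalarField P (D.G.j + 1) P.d) (xh' : ScalarField P (D.G.j + 1) N) : ℝ :=
  D.G.sqForm39 (zeroCharge P.d) (0 : HiggsLattice.VecField P 0) a xh
    + siteInner xh (deltaKA (zeroCharge P.d) Finset.univ (0 : HiggsLattice.VecField P 0) μ a (D.G.j + 1) xh)
    + D.G.sqForm39 C D.Atk1 a xh'
    + siteInner xh' (deltaKA C D.Ω D.Atk msq a (D.G.j + 1) xh')
    - siteInner xh' (D.Hk xh')

/-- Unfolding of `quad37` (definitional). [cite: Balaban1982Higgs2, (3.7) p.584] -/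
theorem quad37_eq (xh : ScalarField P (D.G.j + 1) P.d) (xh' : ScalarField P (D.G.j + 1) N) :
    quad37 C μ msq a D xh xh'
      = D.G.sqForm39 (zeroCharge P.d) (0 : HiggsLattice.VecField P 0) a xh
        + siteInner xh (deltaKA (zeroCharge P.d) Finset.univ (0 : HiggsLattice.VecField P 0) μ a (D.G.j + 1) xh)
        + D.G.sqForm39 C D.Atk1 a xh'
        + siteInner xh' (deltaKA C D.Ω D.Atk msq a (D.G.j + 1) xh')
        - siteInner xh' (D.Hk xh') := rfl

/-- **THE EXPONENT OF (3.7) IS A QUADRATIC POLYNOMIAL IN THE INTEGRATED FIELDS**: for `Λ₅⁽ᵏ⁾ ⊆ Λ₆^{(k−1)′}`, at the field of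
the step `A_k = Λ₅ᶜA_k + x̂`, `φ_k = Λ₅ᶜφ_k + x̂′`,
`exponent37(A_k, φ_k) = exponent37(Λ₅ᶜA_k, Λ₅ᶜφ_k) + lin37(x̂, x̂′) − ½·quad37(x̂, x̂′)` — constant (the value at zero interior
fields) + linear + quadratic, the quadratic part of the averaging lines being `Geom39.sqForm39` (p23 g25 `sqVec37_split`,
`sqScal37_split`). [cite: Balaban1982Higgs2, (3.7) p.584, (3.9) p.585] -/
theorem exponent37_split (h6 : D.G.Λ5 ⊆ D.R6p) (x : In (inSet (P := P) P.d D.G.Λ5) → ℝ)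
    (x' : In (inSet (P := P) N D.G.Λ5) → ℝ) :
    D.exponent37 C μ msq a (fld37 D.G.Λ5 D.Ak x) (fld37 D.G.Λ5 D.φk x')
      = D.exponent37 C μ msq a (cutTo D.G.Λ5ᶜ D.Ak) (cutTo D.G.Λ5ᶜ D.φk)
        + lin37 C μ msq a D (fieldOfCrd D.G.Λ5 x) (fieldOfCrd D.G.Λ5 x')
        - (1 / 2 : ℝ) * quad37 C μ msq a D (fieldOfCrd D.G.Λ5 x) (fieldOfCrd D.G.Λ5 x') := by
  simp only [Data37.exponent37, lin37, quad37]
  rw [D.sqVec37_split a x, D.sqScal37_split a C x', dVec37_fld37 μ a D h6 x, dScal37_fld37 C msq a D h6 x',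
    hForm37_fld37 D h6 x']
  ring

/-! ## §4 (3.7) as a Gaussian integral in the interior coordinates -/

/-- **(3.7) IS A GAUSSIAN INTEGRAL IN `A_k↾_{Λ₅⁽ᵏ⁾}`, `φ_k↾_{Λ₅⁽ᵏ⁾}`** — p. 585 *"Then the integral (3.7), after removing all the
terms independent of these fields, is of the form [(3.9)]"*, the structural half: for `Λ₅⁽ᵏ⁾ ⊆ Λ₇^{(k−1)′}` and `Λ₅⁽ᵏ⁾ ⊆ Λ₆^{(k−1)′}`,
`(3.7) = χ_K⋯χ_{k,Λ₅^{(k)c}} · ρ′⁽ᵏ⁾(…, Λ₇′ᶜA_k, Ã⁽ᵏ⁾, Λ₇′ᶜφ_k) · e^{exponent37(Λ₅ᶜA_k, Λ₅ᶜφ_k)} · ∫dx∫dx′ exp[lin37(x̂, x̂′) − ½quad37(x̂, x̂′)]`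
(the terms independent of the integrated fields in front; p23 g25 `display37_factor` + `exponent37_split`).
[cite: Balaban1982Higgs2, (3.7) p.584, (3.9) p.585] -/
theorem display37_gaussian (h7 : D.G.Λ5 ⊆ D.R7p) (h6 : D.G.Λ5 ⊆ D.R6p) :
    D.display37 C μ msq a
      = D.chiProd37 * D.rhoP (cutTo D.R7pᶜ D.Ak) D.Atk (cutTo D.R7pᶜ D.φk)
          * Real.exp (D.exponent37 C μ msq a (cutTo D.G.Λ5ᶜ D.Ak) (cutTo D.G.Λ5ᶜ D.φk))
          * ∫ x : In (inSet (P := P) P.d D.G.Λ5) → ℝ, ∫ x' : In (inSet (P := P) N D.G.Λ5) → ℝ,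
              Real.exp (lin37 C μ msq a D (fieldOfCrd D.G.Λ5 x) (fieldOfCrd D.G.Λ5 x')
                - (1 / 2 : ℝ) * quad37 C μ msq a D (fieldOfCrd D.G.Λ5 x) (fieldOfCrd D.G.Λ5 x')) := by
  rw [D.display37_factor C μ msq a h7]
  have hexp : ∀ (x : In (inSet (P := P) P.d D.G.Λ5) → ℝ) (x' : In (inSet (P := P) N D.G.Λ5) → ℝ),
      Real.exp (D.exponent37 C μ msq a (fld37 D.G.Λ5 D.Ak x) (fld37 D.G.Λ5 D.φk x'))
        = Real.exp (D.exponent37 C μ msq a (cutTo D.G.Λ5ᶜ D.Ak) (cutTo D.G.Λ5ᶜ D.φk))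
          * Real.exp (lin37 C μ msq a D (fieldOfCrd D.G.Λ5 x) (fieldOfCrd D.G.Λ5 x')
              - (1 / 2 : ℝ) * quad37 C μ msq a D (fieldOfCrd D.G.Λ5 x) (fieldOfCrd D.G.Λ5 x')) := by
    intro x x'
    rw [exponent37_split C μ msq a D h6 x x', add_sub_assoc, Real.exp_add]
  simp_rw [hexp, integral_const_mul]
  ring

/-! ## §5 *"It suffices to use the mass terms in the fundamental operators"* — for (3.7)'s own quadratic form -/

/-- **The mass-term lower bound for `quad37`**: the averaging squares are `≥ 0` (p23 g11 `sqForm39_nonneg`) and the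
fundamental operators are bounded below by their mass terms — `⟨ψ, Δ^{(k),Lᵏε}(Ω, Ã)ψ⟩ ≥ γ(m²)m²‖ψ‖²`, `γ(m) = a_∞/(a_∞ + m)`,
`a_∞ = a(1 − L⁻²)`, every region and field, `k ≥ 1`, `Lᵏε ≤ 1` (r02 g7 `siteInner_deltaKA_succ_ge_uniform`) —, so
`γ(μ₀²)μ₀²‖x̂‖² + γ(m²)m²‖x̂′‖² − ⟨x̂′, H_kx̂′⟩ ≤ quad37(x̂, x̂′)` (m², μ₀² > 0, a > 0, L > 1).
[cite: Balaban1982Higgs2, (3.11) p.585, (3.7) p.584] -/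
theorem quad37_ge (hμ : 0 < μ) (hmsq : 0 < msq) (ha : 0 < a) (hL : 1 < (P.L : ℝ)) (hs : P.mesh (D.G.j + 1) ≤ 1)
    (xh : ScalarField P (D.G.j + 1) P.d) (xh' : ScalarField P (D.G.j + 1) N) :
    a * (1 - ((P.L : ℝ) ^ 2)⁻¹) / (a * (1 - ((P.L : ℝ) ^ 2)⁻¹) + μ) * μ * siteInner xh xh
        + a * (1 - ((P.L : ℝ) ^ 2)⁻¹) / (a * (1 - ((P.L : ℝ) ^ 2)⁻¹) + msq) * msq * siteInner xh' xh'
        - siteInner xh' (D.Hk xh')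
      ≤ quad37 C μ msq a D xh xh' := by
  have h1 := B2Ineq311DeltaKConcrete.siteInner_deltaKA_succ_ge_uniform (zeroCharge P.d) Finset.univ
    (0 : HiggsLattice.VecField P 0) hμ ha hL D.G.hj hs xh
  have h2 := B2Ineq311DeltaKConcrete.siteInner_deltaKA_succ_ge_uniform C D.Ω D.Atk hmsq ha hL D.G.hj hs xh'
  have h3 := D.G.sqForm39_nonneg (zeroCharge P.d) (0 : HiggsLattice.VecField P 0) ha hL xh
  have h4 := D.G.sqForm39_nonneg C D.Atk1 ha hL xh'
  rw [quad37_eq]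
  linarith

/-- ***"It is sufficient to get very weak estimates because we have the strong estimates (3.8), (3.10)"***: if the `H_k`-form is
small on the fields supported in `Λ₅⁽ᵏ⁾` — `⟨x̂′, H_kx̂′⟩ ≤ η‖x̂′‖²` with `η ≤ ½γ(m²)m²` (what (3.8) gives for `r(Lᵏε)` large; rows
B2.Eq2.109, B2.Eq3.11/(3.12)) — then `quad37(x̂, x̂′) ≥ γ(μ₀²)μ₀²‖x̂‖² + ½γ(m²)m²‖x̂′‖²`.
[cite: Balaban1982Higgs2, (3.11) p.585, (3.8) p.584] -/
theorem quad37_ge_of_hForm_le (hμ : 0 < μ) (hmsq : 0 < msq) (ha : 0 < a) (hL : 1 < (P.L : ℝ))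
    (hs : P.mesh (D.G.j + 1) ≤ 1) {η : ℝ}
    (hη : η ≤ (1 / 2 : ℝ) * (a * (1 - ((P.L : ℝ) ^ 2)⁻¹) / (a * (1 - ((P.L : ℝ) ^ 2)⁻¹) + msq) * msq))
    (hH : ∀ xh' : ScalarField P (D.G.j + 1) N, cutTo D.G.Λ5 xh' = xh' → siteInner xh' (D.Hk xh') ≤ η * siteInner xh' xh')
    (xh : ScalarField P (D.G.j + 1) P.d) {xh' : ScalarField P (D.G.j + 1) N} (hxh' : cutTo D.G.Λ5 xh' = xh') :
    a * (1 - ((P.L : ℝ) ^ 2)⁻¹) / (a * (1 - ((P.L : ℝ) ^ 2)⁻¹) + μ) * μ * siteInner xh xh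
        + (1 / 2 : ℝ) * (a * (1 - ((P.L : ℝ) ^ 2)⁻¹) / (a * (1 - ((P.L : ℝ) ^ 2)⁻¹) + msq) * msq) * siteInner xh' xh'
      ≤ quad37 C μ msq a D xh xh' := by
  have h1 := quad37_ge C μ msq a D hμ hmsq ha hL hs xh xh'
  have h2 := hH xh' hxh'
  have h3 : 0 ≤ siteInner xh' xh' := siteInner_self_nonneg xh'
  nlinarith

end Lines

/-! ## §6 Non-vacuity of the two set hypotheses -/

/-- The two set hypotheses are inhabited together with the datum at every level `1 ≤ k ≤ K` (p23 g25's `exists_data37` datum has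
`Λ₆^{(k−1)′} = Λ₇^{(k−1)′} = T⁽ᵏ⁾`); for Bałaban's tower they are theorems (`B2Eq37RemainingIntegralTower`).
[cite: Balaban1982Higgs2, (3.7) p.584, (2.8) p.558] -/
theorem exists_data37_masks {j : ℕ} (hj : j + 1 ≤ P.K) :
    ∃ D : Data37 P N, D.G.j = j ∧ D.G.M = P.K - (j + 1) ∧ D.G.Λ5 ⊆ D.R6p ∧ D.G.Λ5 ⊆ D.R7p := by
  obtain ⟨G, hGj, hGM⟩ := exists_geom39 (P := P) hj
  exact ⟨⟨G, Finset.univ, Finset.univ, Finset.univ, 0, 0, 0, 0, fun _ => 0, fun _ => 0, fun _ _ => 1, fun _ _ _ => 1,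
      fun _ _ _ => 1, 0⟩, hGj, hGM, Finset.subset_univ _, Finset.subset_univ _⟩

end Literature.MathematicalPhysics.QuantumFieldTheory.Balaban1983to89.B2Eq37QuadraticForm

end
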